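import Mathlib
import HarnessLib
import Literature.Probability.RandomPlanarGeometry.BlobTimeDomainLaw
import Summits.CriticalPhenomena.SAWScalingLimit.Theses.SAWCutPointCondensation

/-!
# Route SAWCutPointCondensation — support item `BlobZeroIsSAW`

At blob fugacity `t = 0` the inlined critical blob-time chordal law `BL_0(Ω_δ; a, b)` of route
SAWCutPointCondensation is the critical self-avoiding-walk law `SAW.law Ω δ a b` pushed forward
to curves modulo reparametrisation.  The inlined term of the item is, by `rfl`
(`BlobTime.domainLaw_eq`), the named law `BlobTime.domainLaw 0 Ω δ a b`, and the identity is the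
in-tree theorem `BlobTime.domainLaw_zero` (LawlerSchrammWerner2004SAW §3.1, §3.4.2): the weight
`y_c(0)^{|p|} · 0^{B(p)}` vanishes unless the blob time `B(p)` is `0`, i.e. unless `p` is a path,
where it is `x_c^{|p|}`; the junk normalisations agree because the total masses coincide.
-/

namespace Summit.CriticalPhenomena.SAWScalingLimit.Theorems

open Literature.Probability.RandomPlanarGeometry

/-- **`BL_0 = SAW.law` pushed to curves** (item `BlobZeroIsSAW`, stmt-CriticalPhenomena-7351, of
route SAWCutPointCondensation): for every `Ω, δ, a, b` the critical blob-time law at blob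
fugacity `t = 0` equals `(SAW.law Ω δ a b).map (·.curve)`.  Proof: the item's inlined term is
`BlobTime.domainLaw 0 Ω δ a b` by `BlobTime.domainLaw_eq` (`rfl`), and
`BlobTime.domainLaw_zero` is the identity. -/
theorem blobZeroIsSAW_proof :
    Summit.CriticalPhenomena.SAWScalingLimit.Theses.SAWCutPointCondensation.BlobZeroIsSAW := by
  unfold Summit.CriticalPhenomena.SAWScalingLimit.Theses.SAWCutPointCondensation.BlobZeroIsSAW
  intro Ω δ a b
  exact BlobTime.domainLaw_zero Ω δ a b

end Summit.CriticalPhenomena.SAWScalingLimit.Theorems
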